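import Summits.CriticalPhenomena.Ising3DConformalLimit.Theorems.MoebiusLimitOfTwoPointLaw.Negative.EvenReductionSharp
import Literature.Probability.LatticeModels.PlusStateFKG

/-!
# `MoebiusLimitOfTwoPointLaw` (crux `stmt-CriticalPhenomena-4801`): TRANSLATION INVARIANCE OF THE LIMIT IS FREE TOO
# (negative-side support; second sharpening of `EvenReduction.lean`)

Support file of the crux disprover (cdisprove seat, cycle 2). No continuity of the limit is needed: for an axis
vector `v = a eⱼ` and the meshes `δ_m = |a|/(m+1)`, `v/δ_m ∈ ℤ³`, so `[ (x+v)/δ_m ] = [x/δ_m] + v/δ_m` EXACTLY and a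
lattice-translation-invariant family has equal rescaled correlators at `x + v` and `x` along `δ_m → 0⁺`; pointwise
limits along the full filter then agree (`translationInvariant_of_limit`, MODEL-BLIND, any renormalisation `ρ`);
general `v` is a sum of three axis vectors. The critical correlators of `ℤ³` are lattice-translation invariant in
every arity (`criticalCorr_shift`, from `plusExpect_spinProduct_comp_shift` + `exists_spinMonomial_eq_spinProduct`).
Hence (`moebiusLimitOfTwoPointLaw_iff_even_sharper`): the crux holds iff for every witness `(Δ, c)` of item 0634
there is a family `T` such that for every EVEN `n ≥ 4`: `δ^{-nΔ}⟨σ_{[x₁/δ]}⋯σ_{[xₙ/δ]}⟩_{β_c} → T_n` locally uniformly off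
the diagonals, `T_n` is `O(3)` invariant, and `T_n` is covariant under the unit inversion with weight `Δ`.
(Translation invariance and scale covariance of `T_n` on non-coincident configurations are automatic.) `sorry`-free.
-/

noncomputable section

namespace Summit.CriticalPhenomena.Ising3DConformalLimit.Theorems.MoebiusLimitOfTwoPointLaw.Negative

open Literature.Probability.LatticeModels Filter Topology EuclideanGeometry
open Summit.CriticalPhenomena.Ising3DConformalLimit.Theses.PrecisionLaplacian (MoebiusLimitOfTwoPointLaw)

/-! ## §1 Lattice translation invariance of the critical correlators, every arity -/

/-- Shifting the sites of a spin monomial is shifting the configuration. -/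
theorem spinMonomial_add_const {n : ℕ} (y : Fin n → Site 3) (k : Site 3) :
    spinMonomial (fun i => y i + k) = spinMonomial y ∘ configShift (-k) := by
  funext s
  simp [spinMonomial, spinAt, configShift_apply]

/-- **`⟨∏ σ_{yᵢ + k}⟩_{β_c} = ⟨∏ σ_{yᵢ}⟩_{β_c}` on `ℤ³`**, every arity, coincidences allowed (translation invariance of
the plus state, `plusExpect_spinProduct_comp_shift`, through `exists_spinMonomial_eq_spinProduct`). -/
theorem criticalCorr_shift (n : ℕ) (k : Site 3) (y : Fin n → Site 3) :
    criticalCorr 3 n (fun i => y i + k) = criticalCorr 3 n y := by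
  classical
  obtain ⟨A, hA⟩ := exists_spinMonomial_eq_spinProduct y
  change plusExpect 3 (criticalBeta 3) 0 (spinMonomial fun i => y i + k) =
    plusExpect 3 (criticalBeta 3) 0 (spinMonomial y)
  rw [spinMonomial_add_const, hA]
  exact plusExpect_spinProduct_comp_shift (fun _ => ising_fkg_holds (zdGraph 3)) (criticalBeta_nonneg 3) 0 A (-k)

/-! ## §2 Translation invariance of pointwise limits (model-blind) -/

/-- Rounding commutes with translations by lattice-commensurate vectors: if `v/δ = K ∈ ℤ³` then
`[(p+v)/δ] = [p/δ] + K`. -/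
theorem latticeApprox_add_of_div_eq_int {δ : ℝ} (v : EuclideanSpace ℝ (Fin 3)) (K : Site 3)
    (hK : ∀ j, v j / δ = (K j : ℝ)) (p : EuclideanSpace ℝ (Fin 3)) :
    latticeApprox δ (p + v) = latticeApprox δ p + K := by
  funext j
  rw [latticeApprox_apply, Pi.add_apply, latticeApprox_apply, PiLp.add_apply, add_div, hK j, Int.floor_add_intCast]

/-- The meshes `|a|/(m+1)` tend to `0⁺` (`a ≠ 0`). -/
theorem tendsto_abs_div_succ {a : ℝ} (ha : a ≠ 0) :
    Tendsto (fun m : ℕ => |a| / ((m : ℝ) + 1)) atTop (𝓝[>] (0 : ℝ)) := by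
  rw [tendsto_nhdsWithin_iff]
  refine ⟨?_, Filter.Eventually.of_forall fun m => div_pos (abs_pos.2 ha) (by positivity)⟩
  have h := tendsto_const_div_atTop_nhds_zero_nat (|a|)
  exact (h.comp (tendsto_add_atTop_nat 1)).congr fun m => by simp

/-- Translation invariance of pointwise limits along AXIS vectors, for lattice-translation-invariant families and any
renormalisation. -/
theorem limit_add_axis {G : LatticeCorrFamily 3}
    (hG : ∀ n (k : Site 3) (y : Fin n → Site 3), G n (fun i => y i + k) = G n y)
    (ρ : ℝ → ℝ) {n : ℕ} {T : (Fin n → EuclideanSpace ℝ (Fin 3)) → ℝ}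
    (h : ∀ x ∈ NonCoincident 3 n, Tendsto (fun δ => rescaledCorrelator G ρ n δ x) (𝓝[>] 0) (𝓝 (T x)))
    (j : Fin 3) (a : ℝ) {x : Fin n → EuclideanSpace ℝ (Fin 3)} (hx : x ∈ NonCoincident 3 n) :
    T (fun i => x i + a • EuclideanSpace.single j 1) = T x := by
  set v : EuclideanSpace ℝ (Fin 3) := a • EuclideanSpace.single j 1 with hv
  have hxv : (fun i => x i + v) ∈ NonCoincident 3 n := by
    rw [mem_nonCoincident] at hx ⊢
    exact fun i i' h' => hx (add_right_cancel h')
  rcases eq_or_ne a 0 with ha | ha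
  · have : (fun i => x i + v) = x := by funext i; simp [hv, ha]
    rw [this]
  -- meshes δ_m = |a|/(m+1), lattice shifts K_m = (a/δ_m) e_j ∈ ℤ³
  set δ : ℕ → ℝ := fun m => |a| / ((m : ℝ) + 1) with hδ
  set z : ℕ → ℤ := fun m => if 0 < a then ((m : ℤ) + 1) else -((m : ℤ) + 1) with hz
  have hquot : ∀ m, a / δ m = (z m : ℝ) := by
    intro m
    simp only [hδ, hz]
    rcases lt_or_gt_of_ne ha with hneg | hpos
    · rw [if_neg (not_lt.2 hneg.le), abs_of_neg hneg]
      push_cast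
      field_simp
    · rw [if_pos hpos, abs_of_pos hpos]
      push_cast
      field_simp
  have hK : ∀ m (j' : Fin 3), v j' / δ m = ((Pi.single j (z m) : Site 3) j' : ℝ) := by
    intro m j'
    simp only [hv, PiLp.smul_apply, smul_eq_mul]
    by_cases hj : j' = j
    · subst hj
      rw [Pi.single_eq_same]
      simp [hquot m]
    · rw [Pi.single_eq_of_ne hj]
      simp [hj]
  -- equal rescaled correlators along the sequence
  have heq : ∀ m, rescaledCorrelator G ρ n (δ m) (fun i => x i + v) = rescaledCorrelator G ρ n (δ m) x := by
    intro m
    rw [rescaledCorrelator_apply, rescaledCorrelator_apply]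
    congr 1
    have hcfg : (fun i => latticeApprox (δ m) (x i + v)) = fun i => latticeApprox (δ m) (x i) + Pi.single j (z m) := by
      funext i
      exact latticeApprox_add_of_div_eq_int v _ (hK m) (x i)
    rw [hcfg, hG]
  have hseq := tendsto_abs_div_succ ha
  have h1 := (h _ hxv).comp hseq
  have h2 := (h x hx).comp hseq
  have h12 : (fun m => rescaledCorrelator G ρ n (δ m) (fun i => x i + v)) = fun m => rescaledCorrelator G ρ n (δ m) x :=
    funext heq
  have h1' : Tendsto (fun m => rescaledCorrelator G ρ n (δ m) x) atTop (𝓝 (T fun i => x i + v)) := by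
    rw [← h12]; exact h1
  exact tendsto_nhds_unique h1' h2

/-- **Translation invariance is free** (model-blind): pointwise limits of a lattice-translation-invariant family, under
any renormalisation, are translation invariant on non-coincident configurations. -/
theorem translationInvariant_of_limit {G : LatticeCorrFamily 3}
    (hG : ∀ n (k : Site 3) (y : Fin n → Site 3), G n (fun i => y i + k) = G n y)
    (ρ : ℝ → ℝ) {n : ℕ} {T : (Fin n → EuclideanSpace ℝ (Fin 3)) → ℝ}
    (h : ∀ x ∈ NonCoincident 3 n, Tendsto (fun δ => rescaledCorrelator G ρ n δ x) (𝓝[>] 0) (𝓝 (T x)))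
    (v : EuclideanSpace ℝ (Fin 3)) {x : Fin n → EuclideanSpace ℝ (Fin 3)} (hx : x ∈ NonCoincident 3 n) :
    T (fun i => x i + v) = T x := by
  have mem_add : ∀ (w : EuclideanSpace ℝ (Fin 3)) {y : Fin n → EuclideanSpace ℝ (Fin 3)},
      y ∈ NonCoincident 3 n → (fun i => y i + w) ∈ NonCoincident 3 n := by
    intro w y hy
    rw [mem_nonCoincident] at hy ⊢
    exact fun i i' h' => hy (add_right_cancel h')
  set v₀ : EuclideanSpace ℝ (Fin 3) := v 0 • EuclideanSpace.single 0 1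
  set v₁ : EuclideanSpace ℝ (Fin 3) := v 1 • EuclideanSpace.single 1 1
  set v₂ : EuclideanSpace ℝ (Fin 3) := v 2 • EuclideanSpace.single 2 1
  have hsum : v = v₀ + v₁ + v₂ := by
    ext j'
    fin_cases j' <;> simp [v₀, v₁, v₂]
  have hcfg : (fun i => x i + v) = fun i => ((x i + v₀) + v₁) + v₂ := by
    funext i; rw [hsum]; abel
  rw [hcfg, limit_add_axis hG ρ h 2 (v 2) (mem_add v₁ (mem_add v₀ hx)),
    limit_add_axis hG ρ h 1 (v 1) (mem_add v₀ hx), limit_add_axis hG ρ h 0 (v 0) hx]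

/-! ## §3 The crux, second sharpening: existence + `O(3)` + inversion for the even arities `n ≥ 4` -/

/-- **Reduction of the crux, translations and dilations free.** `MoebiusLimitOfTwoPointLaw` holds iff for every
witness `(Δ, c)` of item 0634 there is a family `T` such that for every EVEN `n ≥ 4`:
`δ^{-nΔ}⟨σ_{[x₁/δ]}⋯σ_{[xₙ/δ]}⟩_{β_c} → T_n` locally uniformly off the diagonals, `T_n` is `O(3)` invariant and covariant
under the unit inversion with weight `Δ`. -/
theorem moebiusLimitOfTwoPointLaw_iff_even_sharper :
    MoebiusLimitOfTwoPointLaw ↔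
      ∀ Δ c : ℝ, 0 < c →
        Tendsto (fun x : Site 3 =>
          criticalTwoPoint 3 x * Real.sqrt (∑ i, ((x i : ℝ)) ^ 2) ^ (2 * Δ)) cofinite (nhds c) →
        ∃ T : CorrFamily 3,
          (∀ n, 4 ≤ n → Even n → TendstoLocallyUniformlyOn
            (rescaledCorrelator (criticalCorr 3) (fun δ => δ ^ (-Δ)) n) (T n) (𝓝[>] (0 : ℝ))
            (NonCoincident 3 n)) ∧
          (∀ n, 4 ≤ n → Even n → ∀ (R : EuclideanSpace ℝ (Fin 3) ≃ₗᵢ[ℝ] EuclideanSpace ℝ (Fin 3))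
            (x : Fin n → EuclideanSpace ℝ (Fin 3)), T n (fun i => R (x i)) = T n x) ∧
          (∀ n, 4 ≤ n → Even n → ∀ x : Fin n → EuclideanSpace ℝ (Fin 3), (∀ i, x i ≠ 0) →
            T n (fun i => inversion 0 1 (x i)) = (∏ i, ‖x i‖ ^ (2 * Δ)) * T n x) := by
  rw [moebiusLimitOfTwoPointLaw_iff_even_sharp]
  constructor
  · intro h Δ c hc hP
    obtain ⟨T, hT, -, hr, hi⟩ := h Δ c hc hP
    exact ⟨T, hT, hr, hi⟩
  · intro h Δ c hc hP
    obtain ⟨T, hT, hr, hi⟩ := h Δ c hc hP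
    -- translation invariance on `NonCoincident` is free; use the truncation to make it global
    refine ⟨truncate T, ?_, ?_, ?_, ?_⟩
    · intro n h4 he
      exact (hT n h4 he).congr_right fun x hx => (truncate_of_mem T hx).symm
    · intro n h4 he v x
      by_cases hx : x ∈ NonCoincident 3 n
      · have hxv : (fun i => x i + v) ∈ NonCoincident 3 n := by
          rw [mem_nonCoincident] at hx ⊢
          exact fun i i' h' => hx (add_right_cancel h')
        rw [truncate_of_mem T hxv, truncate_of_mem T hx]
        exact translationInvariant_of_limit (fun n k y => criticalCorr_shift n k y) _
          (fun y hy => (hT n h4 he).tendsto_at hy) v hx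
      · have hxv : (fun i => x i + v) ∉ NonCoincident 3 n := by
          rw [mem_nonCoincident] at hx ⊢
          exact fun h' => hx fun i i' hii' => h' (by simp [hii'])
        rw [truncate_of_not_mem T hxv, truncate_of_not_mem T hx]
    · intro n h4 he R x
      by_cases hx : x ∈ NonCoincident 3 n
      · have hRx : (fun i => R (x i)) ∈ NonCoincident 3 n := by
          rw [mem_nonCoincident] at hx ⊢
          exact fun i i' h' => hx (R.injective h')
        rw [truncate_of_mem T hRx, truncate_of_mem T hx, hr n h4 he R x]
      · have hRx : (fun i => R (x i)) ∉ NonCoincident 3 n := by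
          rw [mem_nonCoincident] at hx ⊢
          exact fun h' => hx fun i i' hii' => h' (by simp [hii'])
        rw [truncate_of_not_mem T hRx, truncate_of_not_mem T hx]
    · intro n h4 he x h0
      by_cases hx : x ∈ NonCoincident 3 n
      · have hIx : (fun i => inversion 0 1 (x i)) ∈ NonCoincident 3 n := by
          rw [mem_nonCoincident] at hx ⊢
          exact fun i i' h' => hx (inversion_injective (0 : EuclideanSpace ℝ (Fin 3)) one_ne_zero h')
        rw [truncate_of_mem T hIx, truncate_of_mem T hx, hi n h4 he x h0]
      · have hIx : (fun i => inversion 0 1 (x i)) ∉ NonCoincident 3 n := by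
          rw [mem_nonCoincident] at hx ⊢
          exact fun h' => hx fun i i' hii' => h' (by simp [hii'])
        rw [truncate_of_not_mem T hIx, truncate_of_not_mem T hx, mul_zero]

end Summit.CriticalPhenomena.Ising3DConformalLimit.Theorems.MoebiusLimitOfTwoPointLaw.Negative

end
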